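import Summits.HodgeConjecture.HodgeConjecture.Cruxes.BlochSeedDiscOne.SeedCheckerPorteous

/-!
# `Cruxes/BlochSeedDiscOne/SquareDoorClass.lean` — THE SQUARE DEGENERACY DOOR (Thom–Porteous shape `(2,2)`) IS SHUT ON
# THE CLASS SIDE: `Δ₂₂ = c₂² − c₁c₃` of an (A1@Z)-clean two-term datum has `W`-coordinate ZERO; LEMMA TW (twist invariance)

HONEST FRAMING. Typed by planner seat `hsemireg-alphabet-isogeny-1` (g17; director-hodge g20 MINT block B3, isogeny ∕
semi-homogeneous alphabet) for the computation cell `pub-hsemireg`, as EVIDENCE on item stmt-HodgeConjecture-18881. Line of record: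
`line stmt-HodgeConjecture-18881 Cruxes/BlochSeedDiscOne/Lines/birth.lean 814a6a70c14e831a stub_rung_pad4_seedAt` (positive side:
construct ONE (A1)-clean design with `μ ≠ 0` realised by a vector bundle = a SEED). NOTHING here is proved toward HC ∕ HC_CM ∕ HC_AV ∕
№4 ∕ 26512 ∕ 18881 ∕ H2; the stub is untouched; no bundle, map, degeneracy scheme or design is exhibited. This file is a NEGATIVE
class-side record (a door that cannot carry a Weil coordinate) plus two `ring` identities; seats produce evidence and typed files, not rungs.

WHAT IT RECORDS. `SeedCheckerPorteous.lean` §8.3–§8.5 types the CORANK-`1` degeneracy (Thom–Porteous) door: bundles of ranks `a`,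
`a + 3`, locus `D_{a−1}(φ)` of expected codimension `1·4 = 4`, class `c₄(𝓝 − 𝓟)` with `W`-coordinate `−6μ`
(`SeedChecker.virtChernFour_eq_of_virtCleanAtSeed`). On the `8`-fold `S⁴` there is exactly ONE other two-bundle degeneracy shape of
expected codimension `4` whose next stratum is empty for dimension reasons: EQUAL ranks `n`, `n`, locus `D_{n−2}(φ)` (corank `≥ 2`),
expected codimension `2·2 = 4`, next stratum `D_{n−3}` of expected codimension `3·3 = 9 > 8`; its Thom–Porteous class is the
`2 × 2` determinant `Δ⁽²⁾₂(c(𝓝 − 𝓟)) = c₂² − c₁c₃` of the rank-`0` virtual bundle (Fulton, Intersection Theory, Thm. 14.4 with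
`e = f = n`, `k = n − 2`; the shape `(4,1)` = ranks `a + 3 → a` is the dual corank-`1` door, class `c₄(𝓟^∨ − 𝓝^∨)`, nothing new). The
c4-1 g2 door table (`C4-DEGENERACY-LOCI-c4-1-g2.md` §5.3) lists «general two-bundle loci `D_k(E′ → F)`: not analysed»; this file closes the
square shape ON THE CLASS SIDE, for every alphabet at once:

* §1 MODEL RING (any commutative ring, power-sum coordinates `p_k = k!·ch_k`, `p₀ = r` the virtual rank; twist by a line bundle `ℓ`:
  `q_k = Σ_j C(k,j) p_{k−j} ℓ^j`): `pFour = 24·c₄`, `cTwo = 2·c₂`, `cThree = 6·c₃`, `sqFour = 12·Δ₂₂ = 3·cTwo² − 2·p₁·cThree`;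
  **LEMMA TW** `pFour_twist_sub` (`24(c₄(V ⊗ ℓ) − c₄(V)) = (r − 3)·T`, so rank `3` ⟹ twist-invariant: `pFour_twist_rank_three` — the
  kernel form of step (c) of DL-SH, g16 memo `SPLIT-CARRIER-CLASSCERT-isogeny1-g16.md` §5, formerly pen «one line») and `sqFour_twist_sub`
  (`12(Δ₂₂(V ⊗ ℓ) − Δ₂₂(V)) = r·U`, so rank `0` ⟹ twist-invariant: `sqFour_twist_rank_zero`); consistency with the tree's Newton
  conventions `pFour_of_character`, `sqFour_of_character`. All `ring`.
* §2 TREE FRAME (the vocabulary of `SeedChecker.lean` §7.3 ∕ `SeedCheckerPorteous.lean` §8.3, nothing of them restated or shadowed):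
  `newtonTwo`, `newtonThree` (Newton in degrees `2`, `3` on an abstract character; `chernTwo_eq_newtonTwo`, `chernThree_eq_newtonThree` are
  `rfl`), `squareFour x = N₂(x) ∪ N₂(x) − x₁ ∪ N₃(x)` (= `Δ₂₂`), `virtSquareFour C X 𝓝 𝓟 = squareFour (ch 𝓝 − ch 𝓟)` (the Thom–Porteous
  class of the square door, a DEFINITION on the real carrier; nothing asserted); **`squareFour_eq_of_eq`**: `x_p = a_p·h^p` for `p = 1, 2, 3`
  ⟹ `Δ₂₂(x) = (a₁⁴∕12 + a₂² − 2a₁a₃)·h⁴` with NO hypothesis on `x₄`; **THE SQUARE-DOOR `W`-COORDINATE THEOREM**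
  `virtSquareFour_eq_of_virtCleanAtSeed`: (A1@Z) of `[𝓝] − [𝓟]` in a window `⊇ {1, 2, 3}` with ANY `W`-coordinate `μ` ⟹
  `Δ₂₂(𝓝 − 𝓟) = q″·h⁴` — `W`-coordinate `0` (contrast of record: `c₄(𝓝 − 𝓟) = q′·h⁴ + wOf(−6μ)`); the design-level form
  `virtSquareFour_eq_of_realisesTensor` (C0-clean design + the two side realisations, via `SeedChecker.Design.virtCleanAtSeed_of_realisesTensor`);
  and the hypothesis-carrying NO-SEED READING `eq_zero_of_virtSquareFour_eq` (if `h⁴, r₁, r₂` are `ℂ`-independent — true on the anchor, where `h⁴`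
  is Lefschetz and `r₁, r₂` span the Weil plane, but an INPUT here — then `Δ₂₂(𝓝 − 𝓟) = q·h⁴ + wOf μ′` forces `μ′ = 0`).

READING (pen, memo `SQUARE-DOOR-isogeny1-g17.md` in this directory): whatever letters an alphabet offers (monad, isogeny push-forwards `f_*L`,
simple semi-homogeneous bundles, Mukai duals), a square-shape degeneracy locus `D_{n−2}(φ : 𝓟 → 𝓝)` of a two-term datum whose virtual character is
clean in degrees `1–3` (which C0's (A1) forces) has fundamental class in `ℚ·h⁴` (given the shape-`(2,2)` analogue of the localisation law, NOT typed
here), hence can never support `q·h_K⁴ + wOf μ(D)` with `μ(D) ≠ 0` as its own class: the square door produces NO seed for ANY design, at the class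
level already — independently of the object-side checks C5–C7, which are therefore moot for this shape. Of the two-term doors in codimension `4` on
`S⁴` only the corank-`1` door carries `W` (coordinate `−6μ`), and there the records DL-SPLIT ∕ DL-SH (g15 ∕ g16) and the CSL criterion apply.

FLAGS: §1 and §2 are MECH (polynomial identities, Newton book-keeping, linear algebra in `ℚ[h] ⊕ W`); the identification «`[D_{n−2}(φ)] =
Δ₂₂(c(𝓝 − 𝓟))` when `codim D_{n−2}(φ) = 4`» is Fulton Thm. 14.4, quoted, NOT typed (it would be a named law of the kind of
`SeedChecker.PorteousFourLocalisation`, and none is introduced here since the door is shut before it is needed); the independence of `h⁴` from the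
Weil plane is an explicit hypothesis. No `sorry`, no new axiom, no instance, no notation. Still nothing proved toward HC ∕ HC_CM ∕ HC_AV ∕ №4 ∕
26512 ∕ 18881 ∕ H2.
[cite: Fulton1998, Thm. 14.4, Ch. 14 intro (notation `Δ⁽ᵖ⁾_q`), Examples 3.2.2, 3.2.3, 14.4.9, 14.4.10] [cite: HatcherAT2002, §3.2]
-/

noncomputable section

set_option linter.dupNamespace false

open CategoryTheory AlgebraicGeometry
open Literature.AlgebraicGeometry Literature.AlgebraicGeometry.Motives Literature.AlgebraicGeometry.HodgeTheory
open Literature.AlgebraicTopology.SingularHomology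

namespace Summit.HodgeConjecture.HodgeConjecture.Cruxes.BlochSeedDiscOne.SquareDoor

open Summit.HodgeConjecture.HodgeConjecture.Cruxes.BlochSeedDiscOne.Anchor
open Summit.Ventures.HSemireg Summit.Ventures.HSemireg.Pad4Tower

/-! ## §1 MODEL RING: Chern classes of a virtual bundle in power-sum coordinates, twist, LEMMA TW -/

section ModelRing

variable {R : Type*} [CommRing R]

/-- `24·c₄` of a virtual bundle in the power sums `p₁, …, p₄` of its Chern roots (Newton). [cite: Fulton1998, Example 3.2.3] -/
def pFour (p₁ p₂ p₃ p₄ : R) : R :=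
  p₁ ^ 4 - 6 * p₁ ^ 2 * p₂ + 3 * p₂ ^ 2 + 8 * p₁ * p₃ - 6 * p₄

/-- `2·c₂ = p₁² − p₂`. [cite: Fulton1998, Example 3.2.3] -/
def cTwo (p₁ p₂ : R) : R :=
  p₁ ^ 2 - p₂

/-- `6·c₃ = p₁³ − 3p₁p₂ + 2p₃`. [cite: Fulton1998, Example 3.2.3] -/
def cThree (p₁ p₂ p₃ : R) : R :=
  p₁ ^ 3 - 3 * p₁ * p₂ + 2 * p₃

/-- **`12·Δ₂₂ = 12(c₂² − c₁c₃) = 3·(2c₂)² − 2·p₁·(6c₃)`** — twelve times the Thom–Porteous class of the square shape `(2,2)`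
(`Δ⁽²⁾₂ = det [[c₂, c₃], [c₁, c₂]]`). [cite: Fulton1998, Thm. 14.4 and Ch. 14 intro (notation `Δ⁽ᵖ⁾_q`)] -/
def sqFour (p₁ p₂ p₃ : R) : R :=
  3 * cTwo p₁ p₂ ^ 2 - 2 * p₁ * cThree p₁ p₂ p₃

/-- power sums of the twist by a line bundle with first Chern class `ℓ` of a virtual bundle of rank `r`:
`q_k = Σ_j C(k,j)·p_{k−j}·ℓ^j`, `p₀ = r` (roots `αᵢ ↦ αᵢ + ℓ`). [cite: Fulton1998, Example 3.2.2] -/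
def twOne (r p₁ ℓ : R) : R :=
  p₁ + r * ℓ

@[inherit_doc twOne]
def twTwo (r p₁ p₂ ℓ : R) : R :=
  p₂ + 2 * p₁ * ℓ + r * ℓ ^ 2

@[inherit_doc twOne]
def twThree (r p₁ p₂ p₃ ℓ : R) : R :=
  p₃ + 3 * p₂ * ℓ + 3 * p₁ * ℓ ^ 2 + r * ℓ ^ 3

@[inherit_doc twOne]
def twFour (r p₁ p₂ p₃ p₄ ℓ : R) : R :=
  p₄ + 4 * p₃ * ℓ + 6 * p₂ * ℓ ^ 2 + 4 * p₁ * ℓ ^ 3 + r * ℓ ^ 4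

/-- **LEMMA TW (`c₄`, every rank)**: `24·(c₄(V ⊗ ℓ) − c₄(V)) = (r − 3)·(4·(6c₃)ℓ + 6(r−2)(2c₂)ℓ² + 4(r−1)(r−2)c₁ℓ³ + r(r−1)(r−2)ℓ⁴)`
— the factor `(r − 3)` is `C(r − 3, 1)` of `c_k(V ⊗ ℓ) = Σᵢ C(r − i, k − i) cᵢ ℓ^{k−i}`. PROVED (`ring`). [cite: Fulton1998, Example 3.2.2] -/
theorem pFour_twist_sub (r p₁ p₂ p₃ p₄ ℓ : R) :
    pFour (twOne r p₁ ℓ) (twTwo r p₁ p₂ ℓ) (twThree r p₁ p₂ p₃ ℓ) (twFour r p₁ p₂ p₃ p₄ ℓ) - pFour p₁ p₂ p₃ p₄ =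
      (r - 3) * (4 * cThree p₁ p₂ p₃ * ℓ + 6 * (r - 2) * cTwo p₁ p₂ * ℓ ^ 2 + 4 * (r - 1) * (r - 2) * p₁ * ℓ ^ 3 +
        r * (r - 1) * (r - 2) * ℓ ^ 4) := by
  simp only [pFour, cTwo, cThree, twOne, twTwo, twThree, twFour]
  ring

/-- **LEMMA TW, rank `3`** (step (c) of DL-SH, g16): `c₄` of a virtual bundle of rank `3` — the corank-`1` door's datum `[𝓝] − [𝓟]`,
ranks `a + 3`, `a` — is invariant under twisting both terms by the same line bundle. PROVED (`ring`). [cite: Fulton1998, Example 3.2.2] -/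
theorem pFour_twist_rank_three (p₁ p₂ p₃ p₄ ℓ : R) :
    pFour (twOne 3 p₁ ℓ) (twTwo 3 p₁ p₂ ℓ) (twThree 3 p₁ p₂ p₃ ℓ) (twFour 3 p₁ p₂ p₃ p₄ ℓ) = pFour p₁ p₂ p₃ p₄ := by
  simp only [pFour, twOne, twTwo, twThree, twFour]
  ring

/-- **LEMMA TW (`Δ₂₂`, every rank)**: `12·(Δ₂₂(V ⊗ ℓ) − Δ₂₂(V)) = r·(6c₁(2c₂)ℓ − 2(6c₃)ℓ + 6(r−1)c₁²ℓ² + 6(2c₂)ℓ² + 4(r²−1)c₁ℓ³ +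
r(r²−1)ℓ⁴)`. PROVED (`ring`). [cite: Fulton1998, Example 3.2.2 and Ch. 14 intro (notation `Δ⁽ᵖ⁾_q`)] -/
theorem sqFour_twist_sub (r p₁ p₂ p₃ ℓ : R) :
    sqFour (twOne r p₁ ℓ) (twTwo r p₁ p₂ ℓ) (twThree r p₁ p₂ p₃ ℓ) - sqFour p₁ p₂ p₃ =
      r * (6 * p₁ * cTwo p₁ p₂ * ℓ - 2 * cThree p₁ p₂ p₃ * ℓ + 6 * (r - 1) * p₁ ^ 2 * ℓ ^ 2 + 6 * cTwo p₁ p₂ * ℓ ^ 2 +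
        4 * (r ^ 2 - 1) * p₁ * ℓ ^ 3 + r * (r ^ 2 - 1) * ℓ ^ 4) := by
  simp only [sqFour, cTwo, cThree, twOne, twTwo, twThree]
  ring

/-- **LEMMA TW, rank `0`**: `Δ₂₂` of a virtual bundle of rank `0` — the square door's datum `[𝓝] − [𝓟]`, equal ranks — is invariant under
twisting both terms by the same line bundle. PROVED (`ring`). [cite: Fulton1998, Example 3.2.2 and Ch. 14 intro (notation `Δ⁽ᵖ⁾_q`)] -/
theorem sqFour_twist_rank_zero (p₁ p₂ p₃ ℓ : R) :
    sqFour (twOne 0 p₁ ℓ) (twTwo 0 p₁ p₂ ℓ) (twThree 0 p₁ p₂ p₃ ℓ) = sqFour p₁ p₂ p₃ := by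
  simp only [sqFour, cTwo, cThree, twOne, twTwo, twThree]
  ring

/-- consistency with the tree's Newton normalisation (`ch_p = a_p·h^p`, `p_k = k!·ch_k`): `pFour a₁ (2a₂) (6a₃) (24a₄) = 24·N₄(a)` with
`N₄(a) = a₁⁴∕24 − a₁²a₂∕2 + a₂²∕2 + 2a₁a₃ − 6a₄` the scalar of `SeedChecker.newtonFour_eq_of_eq`. PROVED (`ring`). -/
theorem pFour_of_character (a₁ a₂ a₃ a₄ : R) :
    pFour a₁ (2 * a₂) (6 * a₃) (24 * a₄) = a₁ ^ 4 - 12 * (a₁ ^ 2 * a₂) + 12 * a₂ ^ 2 + 48 * (a₁ * a₃) - 144 * a₄ := by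
  simp only [pFour]
  ring

/-- consistency with §2: `sqFour a₁ (2a₂) (6a₃) = 12·(a₁⁴∕12 + a₂² − 2a₁a₃)`, the scalar of `squareFour_eq_of_eq`. PROVED (`ring`). -/
theorem sqFour_of_character (a₁ a₂ a₃ : R) :
    sqFour a₁ (2 * a₂) (6 * a₃) = a₁ ^ 4 + 12 * a₂ ^ 2 - 24 * (a₁ * a₃) := by
  simp only [sqFour, cTwo, cThree]
  ring

end ModelRing

/-! ## §2 TREE FRAME: `Δ₂₂` on an abstract character, the virtual square class, the `W`-coordinate theorem for the square door -/

section TreeFrame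

/-- `(c • x)ⁱ = cⁱ • xⁱ` (private copy, as in `SeedChecker.lean` §4 ∕ `SeedCheckerPorteous.lean` §8.3). [cite: HatcherAT2002, §3.2] -/
private theorem cupPowTwo_smul_aux {Y : Type} [TopologicalSpace Y] (c : ℂ) (x : singularCohomology ℂ ℂ Y 2)
    (i : ℕ) : cupPowTwo (c • x) i = c ^ i • cupPowTwo x i := by
  induction i with
  | zero => rw [cupPowTwo_zero, cupPowTwo_zero, pow_zero, one_smul]
  | succ i ih =>
    rw [cupPowTwo_succ, cupPowTwo_succ, ih]
    simp only [map_smul, LinearMap.smul_apply, smul_smul, pow_succ, mul_comm]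

variable {X : Motives.SchemeOver ℂ}

/-- **NEWTON IN DEGREE `2` ON A CHARACTER**: `N₂(x) = ½ x₁² − x₂` (= `c₂`; §7.3's `chernTwo` with the character abstracted).
[cite: Fulton1998, Example 3.2.3] -/
def newtonTwo (x : (p : ℕ) → complexBetti X (2 * p)) : complexBetti X (2 * 2) :=
  (1 / 2 : ℂ) • cupPowTwo (x 1) 2 - x 2

/-- **NEWTON IN DEGREE `3` ON A CHARACTER**: `N₃(x) = ⅙ x₁³ − x₁ ∪ x₂ + 2x₃` (= `c₃`; §7.3's `chernThree` with the character abstracted).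
[cite: Fulton1998, Example 3.2.3] -/
def newtonThree (x : (p : ℕ) → complexBetti X (2 * p)) : complexBetti X (2 * 3) :=
  (1 / 6 : ℂ) • cupPowTwo (x 1) 3 - cupProduct (rfl : 2 * 1 + 2 * 2 = 2 * 3) (x 1) (x 2) + (2 : ℂ) • x 3

/-- §7.3's `chernTwo` IS `newtonTwo` of the character `p ↦ ch_p(𝓕)`. [`rfl`] -/
theorem chernTwo_eq_newtonTwo (C : ChernCharacterBetti) (X : Motives.SchemeOver ℂ) (𝓕 : X.left.Modules) :
    SeedChecker.chernTwo C X 𝓕 = newtonTwo (fun p => C.ch X 𝓕 p) :=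
  rfl

/-- §7.3's `chernThree` IS `newtonThree` of the character `p ↦ ch_p(𝓕)`. [`rfl`] -/
theorem chernThree_eq_newtonThree (C : ChernCharacterBetti) (X : Motives.SchemeOver ℂ) (𝓕 : X.left.Modules) :
    SeedChecker.chernThree C X 𝓕 = newtonThree (fun p => C.ch X 𝓕 p) :=
  rfl

/-- **THE SQUARE THOM–PORTEOUS CLASS ON A CHARACTER**: `Δ₂₂(x) = N₂(x) ∪ N₂(x) − x₁ ∪ N₃(x)` (`= c₂² − c₁c₃ = det [[c₂, c₃], [c₁, c₂]]`,
the class of the corank-`≥ 2` locus `D_{n−2}(φ)` of a map between bundles of EQUAL rank `n` when it has its expected codimension `2·2 = 4`).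
A DEFINITION. [cite: Fulton1998, Thm. 14.4 and Ch. 14 intro (notation `Δ⁽ᵖ⁾_q`)] -/
def squareFour (x : (p : ℕ) → complexBetti X (2 * p)) : complexBetti X (2 * 4) :=
  cupProduct (rfl : 2 * 2 + 2 * 2 = 2 * 4) (newtonTwo x) (newtonTwo x) -
    cupProduct (rfl : 2 * 1 + 2 * 3 = 2 * 4) (x 1) (newtonThree x)

/-- on an honest character `ch(𝓕)`: `Δ₂₂ = c₂(𝓕) ∪ c₂(𝓕) − c₁(𝓕) ∪ c₃(𝓕)` in §7.3's vocabulary. [`rfl`] -/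
theorem squareFour_ch (C : ChernCharacterBetti) (X : Motives.SchemeOver ℂ) (𝓕 : X.left.Modules) :
    squareFour (fun p => C.ch X 𝓕 p) =
      cupProduct (rfl : 2 * 2 + 2 * 2 = 2 * 4) (SeedChecker.chernTwo C X 𝓕) (SeedChecker.chernTwo C X 𝓕) -
        cupProduct (rfl : 2 * 1 + 2 * 3 = 2 * 4) (SeedChecker.chernOne C X 𝓕) (SeedChecker.chernThree C X 𝓕) :=
  rfl

/-- **THE VIRTUAL SQUARE CLASS `Δ₂₂(𝓝 − 𝓟)`** of a two-term datum on `X`: `squareFour` applied to the virtual character `ch(𝓝) − ch(𝓟)`.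
For vector bundles of the SAME rank `n` this is the Thom–Porteous class `Δ⁽²⁾₂(c(𝓝 − 𝓟))` of the square degeneracy locus
`D_{n−2}(φ)` of a map `φ : 𝓟 → 𝓝` (Fulton Thm. 14.4: `e = f = n`, `k = n − 2`, expected codimension `(e − k)(f − k) = 2·2 = 4`; on the
`8`-fold `S⁴` the next stratum `D_{n−3}` has expected codimension `9 > 8`). A DEFINITION on the real carrier; nothing asserted.
[cite: Fulton1998, Thm. 14.4 and Example 3.2.3] -/
def virtSquareFour (C : ChernCharacterBetti) (X : Motives.SchemeOver ℂ) (𝓝 𝓟 : X.left.Modules) : complexBetti X (2 * 4) :=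
  squareFour (fun p => C.ch X 𝓝 p - C.ch X 𝓟 p)

/-- **`Δ₂₂` IN `ℚ[h] ⊕ W`, CHARACTER FORM — NO DEGREE-`4` INPUT**: `x_p = a_p · h^p` for `p = 1, 2, 3` ALONE give
`Δ₂₂(x) = (a₁⁴∕12 + a₂² − 2a₁a₃) · h⁴`: whatever `x₄` is (in particular whatever its `W`-coordinate), the square class lies on the
`h⁴`-line. PROVED (Newton + bilinearity of `∪`). [cite: Fulton1998, Example 3.2.3 and Ch. 14 intro (notation `Δ⁽ᵖ⁾_q`)] -/
theorem squareFour_eq_of_eq {x : (p : ℕ) → complexBetti X (2 * p)} {h : complexBetti X 2} {a₁ a₂ a₃ : ℂ}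
    (h1 : x 1 = a₁ • cupPowTwo h 1) (h2 : x 2 = a₂ • cupPowTwo h 2) (h3 : x 3 = a₃ • cupPowTwo h 3) :
    squareFour x = (a₁ ^ 4 / 12 + a₂ ^ 2 - 2 * (a₁ * a₃)) • cupPowTwo h 4 := by
  have e1 : x 1 = a₁ • h := by rw [h1, cupPowTwo_one]
  have p22 : cupProduct (rfl : 2 * 2 + 2 * 2 = 2 * 4) (cupPowTwo h 2) (cupPowTwo h 2) = cupPowTwo h 4 :=
    SeedChecker.cupProduct_cupPowTwo_cupPowTwo h 2 2 rfl
  have p13 : cupProduct (rfl : 2 * 1 + 2 * 3 = 2 * 4) h (cupPowTwo h 3) = cupPowTwo h 4 := by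
    have e := SeedChecker.cupProduct_cupPowTwo_cupPowTwo h 1 3 rfl
    rwa [cupPowTwo_one] at e
  have p12 : cupProduct (rfl : 2 * 1 + 2 * 2 = 2 * 3) h (cupPowTwo h 2) = cupPowTwo h 3 := by
    have e := SeedChecker.cupProduct_cupPowTwo_cupPowTwo h 1 2 rfl
    rwa [cupPowTwo_one] at e
  simp only [squareFour, newtonTwo, newtonThree, e1, h2, h3, cupPowTwo_smul_aux, map_smul, LinearMap.smul_apply, map_sub,
    LinearMap.sub_apply, map_add, smul_smul, p22, p13, p12, smul_sub]
  module

variable {E₀ : AbelianVariety ℂ} {ψ₀ : E₀ ⟶ E₀} {C : ChernCharacterBetti}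

/-- **THE `W`-COORDINATE THEOREM FOR THE SQUARE DOOR**: (A1@Z) of `[𝓝] − [𝓟]` in a window `⊇ {1, 2, 3}` with ANY `W`-coordinate `μ`
⟹ **`Δ₂₂(𝓝 − 𝓟) = q″ · h⁴`** — `W`-coordinate ZERO, for every `μ`. Contrast (of record): `c₄(𝓝 − 𝓟) = q′ · h⁴ + wOf(−6μ)`
(`SeedChecker.virtChernFour_eq_of_virtCleanAtSeed`). The square door's class never leaves `ℚ[h]`. PROVED.
[cite: Fulton1998, Thm. 14.4, Ch. 14 intro (notation `Δ⁽ᵖ⁾_q`) and Example 3.2.3] -/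
theorem virtSquareFour_eq_of_virtCleanAtSeed {I : Finset ℕ} {F : SeedChecker.WeilFrame E₀ ψ₀}
    {h : complexBetti (pad4Anchor E₀).X 2} {𝓝 𝓟 : (pad4Anchor E₀).X.left.Modules} {μ : GaussianInt}
    (hcl : SeedChecker.VirtCleanAtSeed C I F h 𝓝 𝓟 μ) (h1 : 1 ∈ I) (h2 : 2 ∈ I) (h3 : 3 ∈ I) :
    ∃ q'' : ℚ, virtSquareFour C (pad4Anchor E₀).X 𝓝 𝓟 = ((q'' : ℚ) : ℂ) • cupPowTwo h 4 := by
  obtain ⟨c, q, hc, -⟩ := hcl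
  refine ⟨c 1 ^ 4 / 12 + c 2 ^ 2 - 2 * (c 1 * c 3), ?_⟩
  rw [virtSquareFour, squareFour_eq_of_eq (x := fun p => C.ch (pad4Anchor E₀).X 𝓝 p - C.ch (pad4Anchor E₀).X 𝓟 p)
    (hc 1 h1 (by decide)) (hc 2 h2 (by decide)) (hc 3 h3 (by decide))]
  push_cast
  ring_nf

/-- **DESIGN LEVEL**: a C0-clean design `D` whose side tensors `T_N(D)`, `T_P(D)` are realised by the two terms `𝓝`, `𝓟` (no exactness, no
ranks, no cokernel) has square class `Δ₂₂(𝓝 − 𝓟) = q″ · h⁴` — for EVERY design, whatever its `μ(D)`. PROVED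
(`SeedChecker.Design.virtCleanAtSeed_of_realisesTensor` in the window `{1, 2, 3}`). -/
theorem virtSquareFour_eq_of_realisesTensor {D : SeedChecker.Design} {F : SeedChecker.WeilFrame E₀ ψ₀}
    {h : complexBetti (pad4Anchor E₀).X 2} {Φ : SeedChecker.WordFrame E₀} (hΦ : Φ.LinksTo F h) (hD : D.Clean)
    {𝓝 𝓟 : (pad4Anchor E₀).X.left.Modules} (hN : SeedChecker.RealisesTensor C Φ 𝓝 D.wchN)
    (hP : SeedChecker.RealisesTensor C Φ 𝓟 D.wchP) :
    ∃ q'' : ℚ, virtSquareFour C (pad4Anchor E₀).X 𝓝 𝓟 = ((q'' : ℚ) : ℂ) • cupPowTwo h 4 :=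
  virtSquareFour_eq_of_virtCleanAtSeed (I := ({1, 2, 3} : Finset ℕ))
    (SeedChecker.Design.virtCleanAtSeed_of_realisesTensor hΦ hD hN hP (by decide)) (by decide) (by decide) (by decide)

/-- **NO-SEED READING (hypothesis-carrying)**: if `h⁴, r₁, r₂` are `ℂ`-independent (on the anchor `h⁴` is a Lefschetz class and `r₁, r₂` span
the Weil plane — an INPUT here, not proved), then an (A1@Z)-clean two-term datum whose square class is written `q · h⁴ + wOf μ′` has `μ′ = 0`:
the square door supports the class `q·h_K⁴ + wOf μ(D)` of `Design.SeedCheck` as its own class for NO design with `μ(D) ≠ 0`. PROVED (linear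
algebra). -/
theorem eq_zero_of_virtSquareFour_eq {I : Finset ℕ} {F : SeedChecker.WeilFrame E₀ ψ₀} {h : complexBetti (pad4Anchor E₀).X 2}
    (hind : ∀ s t u : ℂ, s • cupPowTwo h 4 + t • F.rOne + u • F.rTwo = 0 → s = 0 ∧ t = 0 ∧ u = 0)
    {𝓝 𝓟 : (pad4Anchor E₀).X.left.Modules} {μ : GaussianInt} (hcl : SeedChecker.VirtCleanAtSeed C I F h 𝓝 𝓟 μ)
    (h1 : 1 ∈ I) (h2 : 2 ∈ I) (h3 : 3 ∈ I) {q : ℚ} {μ' : GaussianInt}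
    (hZ : virtSquareFour C (pad4Anchor E₀).X 𝓝 𝓟 = ((q : ℚ) : ℂ) • cupPowTwo h 4 + F.wOf μ') : μ' = 0 := by
  obtain ⟨q'', hq''⟩ := virtSquareFour_eq_of_virtCleanAtSeed hcl h1 h2 h3
  rw [hq'', SeedChecker.WeilFrame.wOf] at hZ
  have h0 : (((q'' : ℚ) : ℂ) - ((q : ℚ) : ℂ)) • cupPowTwo h 4 + (-((μ'.re : ℚ) : ℂ)) • F.rOne +
      (-((μ'.im : ℚ) : ℂ)) • F.rTwo = 0 := by
    rw [sub_smul, hZ, neg_smul, neg_smul]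
    abel
  obtain ⟨-, hre, him⟩ := hind _ _ _ h0
  have hre' : μ'.re = 0 := by exact_mod_cast neg_eq_zero.mp hre
  have him' : μ'.im = 0 := by exact_mod_cast neg_eq_zero.mp him
  ext
  · simpa using hre'
  · simpa using him'

end TreeFrame

/-!
THIS MODULE: §1 defs `pFour`, `cTwo`, `cThree`, `sqFour`, `twOne`–`twFour` (polynomials) and the `ring` identities `pFour_twist_sub`,
`pFour_twist_rank_three` (LEMMA TW rank `3` = DL-SH step (c)), `sqFour_twist_sub`, `sqFour_twist_rank_zero` (LEMMA TW rank `0`),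
`pFour_of_character`, `sqFour_of_character`; §2 defs `newtonTwo`, `newtonThree`, `squareFour`, `virtSquareFour` (definitions on the real carrier,
nothing asserted), `rfl` bridges `chernTwo_eq_newtonTwo`, `chernThree_eq_newtonThree`, `squareFour_ch`, and the PROVED `squareFour_eq_of_eq`,
`virtSquareFour_eq_of_virtCleanAtSeed` (square door: `W`-coordinate `0`), `virtSquareFour_eq_of_realisesTensor`, `eq_zero_of_virtSquareFour_eq`
(independence of `h⁴, r₁, r₂` is a hypothesis). Fulton Thm. 14.4 (`[D_{n−2}(φ)] = Δ₂₂`) is QUOTED, not typed. Nothing proved toward HC ∕ HC_CM ∕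
HC_AV ∕ №4 ∕ 26512 ∕ 18881 ∕ H2; the stub `stub_rung_pad4_seedAt` stays open.
-/

end Summit.HodgeConjecture.HodgeConjecture.Cruxes.BlochSeedDiscOne.SquareDoor

end
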